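import Summits.ResolutionOfSingularities.ResolutionOfSingularities.Theorems.PurelyInseparableDim4Equimultiple
import Literature.AlgebraicGeometry.Resolution.PointBlowupMohBoundPrimePower
import HarnessLib

/-!
# Purely inseparable four-folds `z^p + F(x₁, …, x₄)`: the equimultiple locus is the zero set of the
# Hasse derivatives of order `< p` (brick TY-3b, cell `res-dim4-pi`)

[OURS · counted 0] (D-0157 DOOR 2 wave 2; continues `PurelyInseparableDim4Equimultiple.lean` = TY-3; host item
stmt-ResolutionOfSingularities-16155, helper). Nothing here proves resolution of singularities in dimension ≥ 4 /
characteristic `p`. TY-3 characterised the order-`p` points `(a, b)` of the chart hypersurface `V(z^p + G)`,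
`G = CentreBlowup.chartTransform p S j s.F`, by `a^p + G(b) = 0` and the COEFFICIENT condition
`∀ d ≠ 0, |d| < p → coeff_d G(x + b) = 0` (= `CentreBlowup.IsEquimultiplePoint p S j b s`). Here the coefficient
condition is turned into EQUATIONS IN `b`: by Taylor's formula at a rational point,
`coeff_α G(x + b) = (D^{(α)} G)(b)` for the tree's Hasse–Schmidt derivatives `hasseDeriv K α`
(`HasseSchmidtDerivatives.lean`; `hasseDeriv_translate`, `constantCoeff_hasseDeriv` cited, not restated), so the
equimultiple `b` are the `K`-points of the closed subscheme `V(J_q⁺(G))`, `J_q⁺(G) = ⟨D^{(α)} G : 0 < |α| < q⟩`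
(WITHOUT `G`: its value is absorbed by `z`). This is the statement behind the cell's Scope note T-ISO-1 («the
`q`-fold locus projects onto `V(J_q⁺(F))`», desk WORD #23 (a)), stated over the TREE's `hasseDeriv`; the bridge to the
Scope file's own `PIDim4.hasseDeriv` / `singLocusIdeal` is a separate one-lemma file once that file is in the tree.

* `coeff_translate_eq_eval_hasseDeriv` — Taylor at `b`: `coeff α (G(x + b)) = (D^{(α)} G)(b)` (any field).
* `isEquimultiplePoint_iff_forall_eval_hasseDeriv` — `IsEquimultiplePoint q S j b s ↔ ∀ α ≠ 0, |α| < q →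
  (D^{(α)} G)(b) = 0`; `isEquimultiplePoint_iff_mem_zeroLocus` — `↔ b ∈ V(J_q⁺(G))` (Mathlib `MvPolynomial.zeroLocus`
  of the span of the `D^{(α)} G`, `0 < |α| < q`).
* `le_idealOrder_hypSheaf_iff_mem_zeroLocus_of_isClosed` — `K` algebraically closed: the closed order-`p` points of
  `V(z^p + G) ⊂ 𝔸⁵_K` are exactly the `(a, b)` with `a^p + G(b) = 0` and `b ∈ V(J_p⁺(G))`;
  `existsUnique_point_over_of_mem_zeroLocus` — `K` perfect: over each `b ∈ V(J_p⁺(G))` lies exactly one such `a`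
  (the `p`-fold locus PROJECTS BIJECTIVELY onto `V(J_p⁺(G))(K)`).

Sources: [EGAIV4] Thm. 16.11.2 (the `D_p`); [VillamayorU2008ReesDiff] §2.6, §4.1 (Taylor operators, order via
differential operators); [Hauser2010] §F (equiconstant points); [CossartPiltant2019] Prop. 2.55 (Hasse derivatives and the
multiplicity locus). AI-produced formalisation, weaker than expert review.
bears_on: LADDER-RESOLUTION:D157-DOOR2 (res-dim4-pi · TY-3b).
-/

set_option linter.dupNamespace false -- D-0017: single-problem summit path `Summit.<S>.<S>.…` by design

noncomputable section

open MvPolynomial Finset AlgebraicGeometry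

namespace Summit.ResolutionOfSingularities.ResolutionOfSingularities.Theorems.PIDim4

open Literature.AlgebraicGeometry.Resolution
open Literature.AlgebraicGeometry.Resolution.Hauser2010

namespace Equimultiple

/-! ## §1 Taylor's formula at a rational point -/

section Taylor

variable {σ : Type*} {K : Type*} [Field K]

/-- **Taylor at a rational point**: the coefficient of `x^α` in `G(x + b)` is the value at `b` of the Hasse–Schmidt
derivative `D^{(α)} G` (`G(x + b) = Σ_α (D^{(α)} G)(b) x^α`). [cite: EGAIV4, Thm. 16.11.2 (16.11.2.1)]
[cite: VillamayorU2008ReesDiff, §2.6 (Tay(f(X)) = Σ Δ^α(f(X)) U^α)] -/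
theorem coeff_translate_eq_eval_hasseDeriv (b : σ → K) (α : σ →₀ ℕ) (G : MvPolynomial σ K) :
    coeff α (PointBlowup.translate b G) = eval b (hasseDeriv K α G) := by
  rw [← constantCoeff_hasseDeriv, hasseDeriv_translate]
  exact coeff_zero_translate b _

end Taylor

/-! ## §2 The equimultiple locus as a zero set -/

section Locus

variable {σ : Type*} [DecidableEq σ] {K : Type*} [Field K]

/-- **Equimultiple point ⟺ the Hasse derivatives of order `0 < |α| < q` of the chart transform vanish at `b`.**
[cite: Hauser2010, §F (equiconstant points)] [cite: CossartPiltant2019, Prop. 2.55 (Hasse derivatives)] -/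
theorem isEquimultiplePoint_iff_forall_eval_hasseDeriv (q : ℕ) (S : Finset σ) (j : σ) (b : σ → K)
    (s : CentreBlowup.CState σ K) :
    CentreBlowup.IsEquimultiplePoint q S j b s ↔
      ∀ α : σ →₀ ℕ, α ≠ 0 → α.degree < q →
        eval b (hasseDeriv K α (CentreBlowup.chartTransform q S j s.F)) = 0 := by
  simp only [CentreBlowup.IsEquimultiplePoint, CentreBlowup.pointTransform, coeff_translate_eq_eval_hasseDeriv]

/-- **Equimultiple point ⟺ `b ∈ V(J_q⁺(G))`**, `J_q⁺(G) = ⟨D^{(α)} G : 0 < |α| < q⟩`, `G` the chart transform: the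
equimultiple locus above the centre, read in the chart `x_j`, is the set of `K`-points of a closed subscheme of the
exceptional chart. [cite: CossartPiltant2019, Prop. 2.55 (Hasse derivatives and the locus of multiplicity)] -/
theorem isEquimultiplePoint_iff_mem_zeroLocus (q : ℕ) (S : Finset σ) (j : σ) (b : σ → K)
    (s : CentreBlowup.CState σ K) :
    CentreBlowup.IsEquimultiplePoint q S j b s ↔
      b ∈ MvPolynomial.zeroLocus K (Ideal.span {H | ∃ α : σ →₀ ℕ, 0 < α.degree ∧ α.degree < q ∧
        H = hasseDeriv K α (CentreBlowup.chartTransform q S j s.F)}) := by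
  rw [isEquimultiplePoint_iff_forall_eval_hasseDeriv, MvPolynomial.zeroLocus_span]
  simp only [Set.mem_setOf_eq, pos_iff_ne_zero, ne_eq, Finsupp.degree_eq_zero_iff]
  constructor
  · rintro h H ⟨α, hα0, hαq, rfl⟩
    exact h α hα0 hαq
  · intro h α hα0 hαq
    exact h _ ⟨α, hα0, hαq, rfl⟩

end Locus

/-! ## §3 The order-`p` locus of `V(z^p + G) ⊂ 𝔸⁵_K` projects onto `V(J_p⁺(G))` -/

section Projection

variable {K : Type} [Field K] {p : ℕ} [hp : Fact p.Prime] [CharP K p]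

/-- **`K` algebraically closed: the closed points of order `p` of the chart hypersurface `V(z^p + G)`,
`G = chartTransform p S j s.F`, are exactly the `(a, b)` with `a^p + G(b) = 0` and `b ∈ V(J_p⁺(G))`.**
[cite: Hauser2010, §F (equiconstant points)] [cite: CossartPiltant2019, Prop. 2.55] -/
theorem le_idealOrder_hypSheaf_iff_mem_zeroLocus_of_isClosed [IsAlgClosed K] (S : Finset (Fin 4)) (j : Fin 4)
    (s : State K) {x : AffinePointBlowup.P 4 K} (hx : IsClosed ({x} : Set (AffinePointBlowup.P 4 K))) :
    (p : ℕ∞) ≤ idealOrder (hypSheaf p (CentreBlowup.chartTransform p S j s.F)) x ↔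
      ∃ (a : K) (b : Fin 4 → K),
        x.asIdeal = MvPolynomial.vanishingIdeal K {(Fin.cons a b : Fin (4 + 1) → K)} ∧
          a ^ p + eval b (CentreBlowup.chartTransform p S j s.F) = 0 ∧
            b ∈ MvPolynomial.zeroLocus K (Ideal.span {H | ∃ α : Fin 4 →₀ ℕ, 0 < α.degree ∧ α.degree < p ∧
              H = hasseDeriv K α (CentreBlowup.chartTransform p S j s.F)}) := by
  rw [le_idealOrder_hypSheaf_iff_of_isClosed S j s hx]
  simp only [isEquimultiplePoint_iff_mem_zeroLocus]

/-- **`K` perfect: over each `b ∈ V(J_p⁺(G))` lies exactly one order-`p` point `(a, b)` of `V(z^p + G)`** — the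
`p`-fold locus of the chart hypersurface projects bijectively onto the `K`-points of `V(J_p⁺(G))` (the root
`a = (−G(b))^{1/p}` is what the walk's cleaning step absorbs into `z`). [cite: Hauser2010, §F (equiconstant points)] -/
theorem existsUnique_point_over_of_mem_zeroLocus [PerfectRing K p] (S : Finset (Fin 4)) (j : Fin 4) (s : State K)
    {b : Fin 4 → K}
    (hb : b ∈ MvPolynomial.zeroLocus K (Ideal.span {H | ∃ α : Fin 4 →₀ ℕ, 0 < α.degree ∧ α.degree < p ∧
      H = hasseDeriv K α (CentreBlowup.chartTransform p S j s.F)})) :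
    ∃! a : K, ∀ x : AffinePointBlowup.P 4 K,
      x.asIdeal = MvPolynomial.vanishingIdeal K {(Fin.cons a b : Fin (4 + 1) → K)} →
        (p : ℕ∞) ≤ idealOrder (hypSheaf p (CentreBlowup.chartTransform p S j s.F)) x := by
  have heq : CentreBlowup.IsEquimultiplePoint p S j b s := (isEquimultiplePoint_iff_mem_zeroLocus p S j b s).mpr hb
  obtain ⟨a, ha, huniq⟩ := existsUnique_pow_add_eq_zero (K := K) (p := p)
    (eval b (CentreBlowup.chartTransform p S j s.F))
  refine ⟨a, fun x hx => (isEquimultiplePoint_iff_idealOrder_ge S j b s a ha hx).mp heq, fun a' ha' => huniq a' ?_⟩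
  -- the point `(a', b)` exists as a closed point of `𝔸⁵_K`; its order is `≥ p`, so `a'^p + G(b) = 0`
  let x : AffinePointBlowup.P 4 K :=
    ⟨MvPolynomial.vanishingIdeal K {(Fin.cons a' b : Fin (4 + 1) → K)}, inferInstance⟩
  have hx : x.asIdeal = MvPolynomial.vanishingIdeal K {(Fin.cons a' b : Fin (4 + 1) → K)} := rfl
  have h := ha' x hx
  rw [natCast_le_idealOrder_hypSheaf_iff _ hx, natCast_le_ordZero_translate_hyp_iff] at h
  exact h.1

end Projection

end Equimultiple

end Summit.ResolutionOfSingularities.ResolutionOfSingularities.Theorems.PIDim4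

end
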